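import Literature.AlgebraicGeometry.HodgeTheory.AlgebraicityLocusIUnionClosedProofs
import Literature.AlgebraicGeometry.Motives.ComplexPointsUncountable
import HarnessLib

/-!
# The algebraicity locus over a smooth curve: all of `S(ℂ)` or countable

Topic `Literature/AlgebraicGeometry/HodgeTheory` (family `hodge`). Theorems only (no definition, no
named fact; D-0026). A corollary of the tree's THEOREM
`charlesSchnell_algebraicityLocus_iUnion_closed_holds` (`AlgebraicityLocusIUnionClosedProofs.lean`:
for a smooth projective family `f : 𝒳 ⟶ S` of quasi-projective complex schemes over a smooth base,
the set of complex points `t ∈ S(ℂ)` at which the fibre restriction of a global class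
`A ∈ H²ᵖ(𝒳(ℂ); ℂ)` is algebraic is `⋃_j W_j(ℂ)` for countably many Zariski-closed `W_j ⊆ S`;
Charles–Schnell, proof of Prop. 11.3.11; Voisin, *Hodge Theory II*, §3.3.1 and §7.3.2) read over a
ONE-DIMENSIONAL base: on a smooth integral curve a proper Zariski-closed subset is a finite set of
closed points, so

* `algebraicityLocus_eq_univ_or_countable_of_smoothCurve` — **over a smooth integral
  quasi-projective curve the algebraicity locus of a global class is either ALL of `S(ℂ)` or a
  COUNTABLE set of complex points** ("if `f ∈ B` is general and `f ∈ p_i(H_i)`, then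
  `p_i(H_i) = B`", Voisin II §7.3.2, in the form: a locus containing uncountably many points
  contains a `W_j(ℂ)` with `W_j` infinite, hence `W_j = S`);
* `algebraicityLocus_eq_univ_of_not_countable_of_smoothCurve`,
  `mem_algebraicClasses_of_not_countable_of_smoothCurve` — the consumer's form: if the fibre
  restrictions of `A` are algebraic over an uncountable set of complex points, they are algebraic
  at EVERY complex point.

Bookkeeping proved on the way: `finite_of_isClosed_of_top_notMem` (a closed subset of a smooth
integral curve missing the generic point is finite) and
`finite_setOf_pt_mem_of_isClosed_of_ne_univ` (the complex points over a proper closed subset of a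
smooth integral curve form a finite set).

Consumer: the crux line `padic-disc-transport` of
`Summits/HodgeConjecture/HodgeConjecture/Cruxes/VariationalHodge` (stub `GenericPropagation`: a
class algebraic at ONE fibre over a `k`-generic point of a curve is algebraic on every fibre — by
spreading it is algebraic over the uncountably many complex points of a dominant family, which this
file turns into "every point" for quasi-projective total spaces).

## References

* [CharlesSchnell2014Notes] F. Charles, C. Schnell, Notes on absolute Hodge classes (2014),
  Prop. 11.3.11 (proof) and Lemma 11.3.14.
* [VoisinHodgeII2003] C. Voisin, Hodge Theory and Complex Algebraic Geometry II (2003), §3.3.1 and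
  §7.3.2 (proof of Thm. 7.19).
* [Hartshorne1977] R. Hartshorne, Algebraic Geometry (1977), I Prop. 1.5, II Ex. 3.13 (Noetherian
  induction; irreducible components), II Ex. 4.9.
-/

noncomputable section

open CategoryTheory AlgebraicGeometry Set Order
open _root_.Topology TopologicalSpace
open Literature.AlgebraicGeometry.Motives

namespace Literature.AlgebraicGeometry.HodgeTheory

section CurveBase

variable {S : Motives.SchemeOver ℂ} [IsIntegral S.left] [SmoothOfRelativeDimension 1 S.hom]

/-- **A closed subset of a smooth integral curve missing the generic point is finite**: it is a
finite union of irreducible closed subsets (`S` is Noetherian), each the closure of its generic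
point `ζ ≠ ⊤`, and a non-generic point of a smooth integral curve specialises only to itself
(`eq_of_specializes_of_ne_top`), so each is a singleton. [cite: Hartshorne1977, Ch. I Prop. 1.5 and Ch. II Ex. 3.13] -/
theorem finite_of_isClosed_of_top_notMem [NoetherianSpace S.left] {W : Set S.left}
    (hW : IsClosed W) (htop : (⊤ : S.left) ∉ W) : W.Finite := by
  obtain ⟨F, hFf, -, hFirr, hWF⟩ := NoetherianSpace.exists_finite_set_isClosed_irreducible hW
  rw [hWF]
  refine hFf.sUnion fun t ht => ?_
  have htW : t ⊆ W := hWF ▸ Set.subset_sUnion_of_mem ht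
  -- `t` is the closure of its generic point `ζ ≠ ⊤`, hence `t = {ζ}`
  set ζ := (hFirr t ht).genericPoint with hζ
  have hζt : closure ({ζ} : Set S.left) = closure t := (hFirr t ht).genericPoint_closure_eq
  have hζmem : ζ ∈ W := by
    have h1 : ζ ∈ closure t := hζt ▸ subset_closure (Set.mem_singleton ζ)
    exact hW.closure_subset_iff.2 htW h1
  have hζtop : ζ ≠ ⊤ := fun h => htop (h ▸ hζmem)
  refine (Set.finite_singleton ζ).subset fun y hy => ?_
  have hy' : y ∈ closure ({ζ} : Set S.left) := hζt ▸ subset_closure hy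
  exact Set.mem_singleton_iff.2 (eq_of_specializes_of_ne_top hζtop (specializes_iff_mem_closure.2 hy'))

omit [SmoothOfRelativeDimension 1 S.hom] in
/-- **A proper closed subset of a smooth integral curve misses the generic point** (the closure of
the generic point — the unique point dense in the irreducible `S` — is everything).
[cite: Hartshorne1977, Ch. II Ex. 2.9] -/
theorem top_notMem_of_isClosed_of_ne_univ {W : Set S.left} (hW : IsClosed W) (hWu : W ≠ Set.univ) :
    (⊤ : S.left) ∉ W := by
  intro htop
  apply hWu
  refine Set.eq_univ_of_forall fun x => ?_
  have hx : (⊤ : S.left) ⤳ x := Scheme.le_iff_specializes.1 le_top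
  exact hW.closure_subset_iff.2 (Set.singleton_subset_iff.2 htop) (specializes_iff_mem_closure.1 hx)

/-- **The complex points over a proper Zariski-closed subset of a smooth integral curve form a
finite set** (`S` locally of finite type over `ℂ` with Noetherian underlying space): the closed
set is finite (`finite_of_isClosed_of_top_notMem`) and a complex point is determined by its
underlying point (`Motives.ComplexPoints.ext_of_pt_eq`). [cite: Hartshorne1977, Ch. I Prop. 1.5 and Ch. II Ex. 3.13] -/
theorem finite_setOf_pt_mem_of_isClosed_of_ne_univ [NoetherianSpace S.left]
    [LocallyOfFiniteType S.hom] {W : Set S.left} (hW : IsClosed W) (hWu : W ≠ Set.univ) :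
    {t : Motives.ComplexPoints S | t.pt ∈ W}.Finite := by
  have hfin : W.Finite := finite_of_isClosed_of_top_notMem hW (top_notMem_of_isClosed_of_ne_univ hW hWu)
  exact hfin.preimage fun t _ t' _ h => Motives.ComplexPoints.ext_of_pt_eq h

variable {𝒳 : Motives.SchemeOver ℂ} (f : 𝒳 ⟶ S)

/-- **Over a smooth integral quasi-projective curve, the algebraicity locus of a global class is
all of `S(ℂ)` or countable.** For a smooth projective family `f : 𝒳 ⟶ S` of relative dimension `n`
with `𝒳` and `S` quasi-projective over `ℂ`, `S` a smooth integral curve, and `A ∈ H²ᵖ(𝒳(ℂ); ℂ)`,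
the set of complex points `t` with `A|_{𝒳_t} ∈ Nᵖ H²ᵖ(𝒳_t(ℂ); ℂ)` is `⋃_j W_j(ℂ)` for countably
many closed `W_j ⊆ S` (`charlesSchnell_algebraicityLocus_iUnion_closed_holds`); either some
`W_j = S`, or every `W_j(ℂ)` is finite (`finite_setOf_pt_mem_of_isClosed_of_ne_univ`).
[cite: CharlesSchnell2014Notes, Prop. 11.3.11 (proof)] [cite: VoisinHodgeII2003, §7.3.2 (proof of Thm. 7.19)] -/
theorem algebraicityLocus_eq_univ_or_countable_of_smoothCurve {n : ℕ}
    (h𝒳 : IsQuasiProjectiveOver 𝒳) (hS : IsQuasiProjectiveOver S)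
    (hf : Motives.IsSmoothProjectiveFamily f n) (p : ℕ) (A : complexBetti 𝒳 (2 * p)) :
    {t : Motives.ComplexPoints S |
        complexBetti.map (Motives.fiberι f t) (2 * p) A ∈
          algebraicClasses (Motives.fiberOver f t) p} = Set.univ ∨
      {t : Motives.ComplexPoints S |
        complexBetti.map (Motives.fiberι f t) (2 * p) A ∈
          algebraicClasses (Motives.fiberOver f t) p}.Countable := by
  haveI : Smooth S.hom := SmoothOfRelativeDimension.smooth 1 S.hom
  haveI : LocallyOfFiniteType S.hom := IsQuasiProjectiveOver.locallyOfFiniteType hS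
  haveI : NoetherianSpace S.left := noetherianSpace_of_isProper_of_isQuasiProjectiveOver (𝟙 S) hS
  obtain ⟨W, hW, hL⟩ := charlesSchnell_algebraicityLocus_iUnion_closed_holds f n p h𝒳 hS
    inferInstance hf A
  rw [hL]
  by_cases huniv : ∃ j, W j = Set.univ
  · obtain ⟨j, hj⟩ := huniv
    left
    refine Set.eq_univ_of_forall fun t => Set.mem_iUnion.2 ⟨j, ?_⟩
    change t.pt ∈ W j
    rw [hj]; exact Set.mem_univ _
  · right
    push Not at huniv
    exact Set.countable_iUnion fun j =>
      (finite_setOf_pt_mem_of_isClosed_of_ne_univ (hW j) (huniv j)).countable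

/-- **Uncountably many algebraic fibres force all fibres**: under the hypotheses of
`algebraicityLocus_eq_univ_or_countable_of_smoothCurve`, if the algebraicity locus of `A` is not
countable it is all of `S(ℂ)`. [cite: CharlesSchnell2014Notes, Prop. 11.3.11 (proof)] -/
theorem algebraicityLocus_eq_univ_of_not_countable_of_smoothCurve {n : ℕ}
    (h𝒳 : IsQuasiProjectiveOver 𝒳) (hS : IsQuasiProjectiveOver S)
    (hf : Motives.IsSmoothProjectiveFamily f n) (p : ℕ) (A : complexBetti 𝒳 (2 * p))
    (hnc : ¬ {t : Motives.ComplexPoints S |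
        complexBetti.map (Motives.fiberι f t) (2 * p) A ∈
          algebraicClasses (Motives.fiberOver f t) p}.Countable) :
    {t : Motives.ComplexPoints S |
        complexBetti.map (Motives.fiberι f t) (2 * p) A ∈
          algebraicClasses (Motives.fiberOver f t) p} = Set.univ :=
  (algebraicityLocus_eq_univ_or_countable_of_smoothCurve f h𝒳 hS hf p A).resolve_right hnc

/-- **Pointwise form**: if the fibre restrictions of `A` are algebraic over a set of complex
points of the smooth integral quasi-projective curve `S` which is NOT countable, then `A|_{𝒳_t}`
is algebraic at every complex point `t`. [cite: CharlesSchnell2014Notes, Prop. 11.3.11 (proof) and Lemma 11.3.14] -/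
theorem mem_algebraicClasses_of_not_countable_of_smoothCurve {n : ℕ}
    (h𝒳 : IsQuasiProjectiveOver 𝒳) (hS : IsQuasiProjectiveOver S)
    (hf : Motives.IsSmoothProjectiveFamily f n) (p : ℕ) (A : complexBetti 𝒳 (2 * p))
    {G : Set (Motives.ComplexPoints S)} (hG : ¬ G.Countable)
    (hGalg : ∀ t ∈ G, complexBetti.map (Motives.fiberι f t) (2 * p) A ∈
      algebraicClasses (Motives.fiberOver f t) p)
    (t : Motives.ComplexPoints S) :
    complexBetti.map (Motives.fiberι f t) (2 * p) A ∈ algebraicClasses (Motives.fiberOver f t) p := by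
  have hnc : ¬ {t : Motives.ComplexPoints S |
      complexBetti.map (Motives.fiberι f t) (2 * p) A ∈
        algebraicClasses (Motives.fiberOver f t) p}.Countable :=
    fun hc => hG (hc.mono fun t ht => hGalg t ht)
  have h := algebraicityLocus_eq_univ_of_not_countable_of_smoothCurve f h𝒳 hS hf p A hnc
  have ht : t ∈ (Set.univ : Set (Motives.ComplexPoints S)) := Set.mem_univ t
  rw [← h] at ht
  exact ht

omit [IsIntegral S.left] in
/-- **The whole curve is uncountable**: `S(ℂ)` itself is not a countable set of complex points (a
smooth curve locally of finite type over `ℂ` with a complex point has uncountably many,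
`Motives.ComplexPoints.not_countable_of_smoothOfRelativeDimension`) — recorded so that the
dichotomy is visibly non-vacuous. [cite: SerreGAGA1956, §2 n°5 Prop. 2] -/
theorem not_countable_univ_complexPoints_of_smoothCurve [LocallyOfFiniteType S.hom]
    (P : Motives.ComplexPoints S) : ¬ (Set.univ : Set (Motives.ComplexPoints S)).Countable := by
  intro h
  haveI : Countable (Motives.ComplexPoints S) := Set.countable_univ_iff.1 h
  exact Motives.ComplexPoints.not_countable_of_smoothOfRelativeDimension S 1 Nat.one_pos P
    inferInstance

end CurveBase

end Literature.AlgebraicGeometry.HodgeTheory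

end
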